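import Literature.MathematicalPhysics.QuantumFieldTheory.Balaban1983to89.B13XinvCentreDecayOfReg335

/-!
# `Balaban1983to89.B13XinvSymLettersOfReg335` — T. Bałaban, *Propagators for lattice gauge theories in a background field*, Commun. Math. Phys. **99** (1985) 389–434
# [Balaban1985BackgroundPropagators], (3.25) pp. 394–395, (3.35) p. 396, Thm 3.2 (3.48) p. 398, Thm 3.4 p. 400, (3.66)–(3.70) pp. 403–404, Thm 3.10 (3.107)–(3.108) p. 416;
# *Renormalization group approach … II*, Commun. Math. Phys. **116** (1988) 1–22 [Balaban1988RG2Cluster] (2.5)–(2.7) pp. 12–13, p. 15: ★★★ **THE X⁻¹ KNIT — THE N10 LETTERS OF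
# `A′ ↦ (Q′G′²Q′*)⁻¹(e^{iηA′}U₀)` AT def-Y's v4 LETTERS FOR EVERY BACKGROUND OF THE (3.35) CLASS, WITH NO N06 BINDER LEFT** (the X⁻¹ twin of the lane's module 79)

statement-level skeleton of published theorems with citation tags; proofs where landed; nothing here is a claim about the Yang–Mills mass gap

THE PRINT.  (3.66)–(3.70) pp. 403–404: *«the operator Q′G′²Q′\*(U′U) … analytic in A′»*; Thm 3.2 p. 398: *«|(Q′(U)G′²(U)Q′\*(U))⁻¹(y,y′)| ≤ B₀(Lʲη)⁻⁴(Lʲ′η)^{−d}e^{−δ₀d(y,y′)}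
(3.48)»*; [Balaban1988RG2Cluster] p. 15: the propagators of [13] enter the (2.14) terms through their analytic extensions along `U = e^{iηA′}U₀`.

WHY THIS FILE (cell `pub-ymgap`, D-0062 ∕ D-0149 ∕ D-0154, Track A node N10 = [B13]; width seat `pub-ymgap-dag-n10-w5` g3, INTENT-2 on the n10-c lane's LOCATED X⁻¹ recipe
(HOME INBOX l.29493) after its step (ii) ∕ readout file `B13XinvCentreDecayOfReg335` (p613219)).  n10-w2's transporter-generic X⁻¹-JUNCTION
`B13OpsYPencilXQuadGen.rawEntryLetters_toMatrix_XinvY_parSymY_prodCfg_of_pencil` turns the pencil letters of `G′` plus the two N06 binders at the centre (`hunit`,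
`hO`) into the pencil letters of `X⁻¹ = (Q′G′²Q′*)⁻¹`.  On the (3.35) class ALL three inputs are now tree theorems: `G′`'s letters = the lane's 79
(`B13GreenPrimeSymLettersOfReg335.rawEntryLetters_toMatrix_GpY_parSymY_prodCfg_of_reg335_record`, from n06-w1's Thm 3.1 decay + dag-n06-j's invertibility), and
`hunit ∕ hO` = `B13XinvCentreDecayOfReg335.norm_XinvY_parSymY_single_le_of_reg335` (n06-w1's coercivity through the lane's 80 ∕ 81 + step (ii)).  THIS FILE composes
them (the rate of `G′`'s letters lowered by module 34's `rawEntryLetters_mono` to `κ + μ`, so that the junction's centre rate `ρ − μ` IS the located `κ`):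
* §1 ★★ `rawEntryLetters_toMatrix_XinvY_parSymY_prodCfg_of_letters_located` — every `G`-valued `U₀` (`G ≤ U(N)`), `G′`'s pencil letters `(R, ρ, B_G′)` DISPLAYED: the letters
  of `A′ ↦ toMatrix B′ B′ (X⁻¹(e^{iηA′}U₀))` through `ℓB ∘ fst` at every rate `0 ≤ ρ″ < κ`, constant `2·(1·1·B_X)`, `B_X = N³·(√((L^k)^{d+1})·4∕(4(d+1)+1)⁻²)`, at a thin
  radius `0 < R₁ ≤ R` (the X⁻¹-junction's located quotient — stated `∃ R₁`, the two-storey numeral is not displayed).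
* §2 ★★★ `rawEntryLetters_toMatrix_XinvY_parSymY_prodCfg_of_reg335` — `U₀ ∈ (bg9K (M_N ℂ) G i).Reg335 c α₀` (`0 ≤ c·M·α₀`, `c·M·α₀·(d+1) ≤ 1∕16`): the same with `G′`'s
  letters DISCHARGED by 79 at its own located radius (`thinRadius_pos ∕ _le`), `0 < R₁ ≤ Rc` — NO N06 binder: displayed are NODE 00's dictionary numerals (`D′, Cavg` of the
  averaging; `D, CQ, CQs` of `Q′`; the readings `ℓS, ℓB` with `s, κr, r`; fibre bounds `m_S, m_B`), the pencil's `η` and `Rc > 0`, and the rate chain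
  `0 ≤ ρ″ < κ ≤ (ρ′ − μ)∕4`, `0 < μ < ρ′ < δ₀κr` with the ONE 81-shape smallness of `κ`.
HONEST FRAMING ∕ SCOPE: pure composition of cited TREE theorems (79, 81 via p613219, XQuadGen, module 34); scope = n06-w1's (ONE finite lattice operator, rates per lattice
step at the coarsest scale through the readings; NOT print's multi-scale `d(y,y′)`, NOT (3.48)'s scale factors `(Lʲη)⁻⁴(Lʲ′η)^{−d}`); which `ℓS ∕ ℓB ∕ η ∕ U₀` and which
letter family (v2 ∕ v4) are «of record» is NODE 00's ∕ def-Y's ∕ def-T's word; the bond-sector `G = Δ_a⁻¹` (Thm 3.3) is NOT touched; nothing of Bałaban's asserted beyond the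
cited theorems; N06 ∕ N10 NOT discharged; K1⁷ NOT closed; counts unmoved (typed 28∕28 · discharged 5∕27); THEOREMS ONLY (0 `def` ∕ `instance` ∕ `notation`), 0 `sorry`,
standard axioms; one finite 𝕋⁴ programme at fixed ε — R4 closes the conditional finite-𝕋⁴ rung `BalabanLadder.UV` only; the YM mass gap (Clay) is NOT proved by any of this;
nothing continuum ∕ ℝ⁴ ∕ OS.

v1.0.1 (DOCSTRING-ONLY; declarations byte-identical): [B9] locators per lit-balaban-r06 g67 (HOME INBOX l.31667) — the (3.48) quotation's scale factor `(Lʲη)⁻⁴` (print p. 398), «(3.66)–(3.70)» pp. 403–404, «(3.25)» p. 394.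

References: T. Bałaban, CMP 99 (1985) 389–434 [Balaban1985BackgroundPropagators] (3.25) pp.394–395, (3.35) p.396, Thm 3.2 (3.48) pp.398–399, Thm 3.4 p.400, (3.66)–(3.70)
pp.403–404, Thm 3.10 (3.107)–(3.108) p.416; CMP 96 (1984) 223–250 [Balaban1984PropagatorsII] Prop 2.3 p.238, Lemma 2.1 (2.61) p.234; CMP 116 (1988) 1–22 [Balaban1988RG2Cluster]
(2.5)–(2.7) pp.12–13, p.15.
-/

noncomputable section

namespace Literature.MathematicalPhysics.QuantumFieldTheory.Balaban1983to89.B13XinvSymLettersOfReg335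

open Metric Set Finset Module
open scoped Matrix ComplexConjugate Matrix.Norms.L2Operator
open Literature.MathematicalPhysics.QuantumFieldTheory.Balaban1983to89
open Node00 B6KLevelCensusIndexV1 B6Geom246MultiLevelBox B6MultiLevelBoxOperator B6MultiLevelTorusOperator B6GlobalChartV1 B9BackgroundsKLevelV1
open Literature.MathematicalPhysics.QuantumFieldTheory.Balaban1983to89.B4TorusKernel.MultiPeriod (torusSupNorm)
open Literature.MathematicalPhysics.QuantumFieldTheory.Balaban1983to89.B9Thm37GlueTorus (tdist1)
open Literature.MathematicalPhysics.QuantumFieldTheory.Balaban1983to89.B5TorusCover (UT)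
open Literature.MathematicalPhysics.QuantumFieldTheory.Balaban1983to89.B9Eq39Adjoint (prodCfg)
open Literature.MathematicalPhysics.QuantumFieldTheory.Balaban1983to89.B13EntrywiseWalks (RawEntryLetters)
open Literature.MathematicalPhysics.QuantumFieldTheory.Balaban1983to89.B13EntryLetterAlgebra (rawEntryLetters_mono)
open Literature.MathematicalPhysics.QuantumFieldTheory.Balaban1983to89.B13InverseLettersNeumannRadius (thinRadius_pos thinRadius_le)
open Literature.MathematicalPhysics.QuantumFieldTheory.Balaban1983to89.B13MatrixUnitBasisNumerals (norm_stdBasis_repr_le norm_stdBasis_le_one)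
open Literature.MathematicalPhysics.QuantumFieldTheory.Balaban1983to89.B13GreenPrimeSymLettersOfReg335
  (norm_unit_le_one_of_mem rawEntryLetters_toMatrix_GpY_parSymY_prodCfg_of_reg335_record)
open Literature.MathematicalPhysics.QuantumFieldTheory.Balaban1983to89.B13OpsYPencilXQuadGen (rawEntryLetters_toMatrix_XinvY_parSymY_prodCfg_of_pencil)
open Literature.MathematicalPhysics.QuantumFieldTheory.Balaban1983to89.B13XinvCentreDecayOfReg335
  (norm_XinvY_parSymY_single_le_of_letters norm_XinvY_parSymY_single_le_of_reg335)

variable {d ℓ : ℕ} {hd : 1 ≤ d + 1} {hL : Odd (ℓ + 1) ∧ 1 < ℓ + 1} {b₀ b₁ : ℝ} (i : KIdx d ℓ hd hL b₀ b₁) {N : ℕ} [NeZero N]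
variable {G : Subgroup (Matrix (Fin N) (Fin N) ℂ)ˣ} [DecidableEq (BlkY i)] {ν : ℕ} {Nf : Fin ν → ℕ} [∀ j, NeZero (Nf j)]

/-! ## §1. ★★ The X⁻¹-junction fed with the centre fact — `G′`'s pencil letters displayed -/

/-- ★★ **THE X⁻¹ KNIT MODULO `G′`'s PENCIL LETTERS.**  At EVERY `G`-valued background `U₀` (`G ≤ U(N)`): from the pencil letters `(R, ρ, B_G′)` of `G′ = GpY i (parSymY i)` on
sites (DISPLAYED), NODE 00's numerals `D, CQ, CQs, r`, fibre bounds `m_S, m_B`, a rate loss `0 < μ < ρ`, ONE located rate `κ` (`0 ≤ κ ≤ (ρ−μ)∕4` with the 81-shape smallness)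
and a target rate `0 ≤ ρ″ < κ`: the N10 letters of `A′ ↦ toMatrix B′ B′ ((Q′G′²Q′*)⁻¹(e^{iηA′}U₀))` through `ℓB ∘ fst` at rate `ρ″`, constant `2·(1·1·B_X)`, at a thin radius
`0 < R₁ ≤ R` — n10-w2's junction `rawEntryLetters_toMatrix_XinvY_parSymY_prodCfg_of_pencil` with `hunit ∕ hO := norm_XinvY_parSymY_single_le_of_letters` and `G′`'s letters
rate-lowered to `κ + μ` (`rawEntryLetters_mono`).  [cite: Balaban1985BackgroundPropagators, (3.25) p.394, Thm 3.2 (3.48) p.398, Thm 3.4 p.400, (3.66)–(3.70) pp.403–404, Thm 3.10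
(3.107)–(3.108) p.416; Balaban1988RG2Cluster, (2.5)–(2.7) pp.12–13, p.15] -/
theorem rawEntryLetters_toMatrix_XinvY_parSymY_prodCfg_of_letters_located (hG : G ≤ B7Prop2Explicit.unitaryUnits (Matrix (Fin N) (Fin N) ℂ))
    {U₀ : CfgY (Matrix (Fin N) (Fin N) ℂ) i} (hU : ∀ μ x, U₀ μ x ∈ G) (η : ℝ)
    {R Rc : ℝ} (hR : 0 < R) (hRRc : R ≤ Rc) {D : ℕ}
    (hD : ∀ s z, qpK i s z ≠ 0 → Site.tdist ((boxEquiv i.hN).symm (blkCornerY i s)) ((boxEquiv i.hN).symm z) ≤ D)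
    (hDs : ∀ z s, qpsK i z s ≠ 0 → Site.tdist ((boxEquiv i.hN).symm (blkCornerY i s)) ((boxEquiv i.hN).symm z) ≤ D)
    {CQ CQs : ℝ} (hCQ0 : 0 ≤ CQ) (hCQ : ∀ s, ∑ z, |qpK i s z| ≤ CQ) (hCQs0 : 0 ≤ CQs) (hCQs : ∀ s, ∑ z, |qpsK i z s| ≤ CQs)
    (ℓS : SiteY i → UT Nf) (ℓB : BlkY i → UT Nf) {r : ℝ}
    (hℓQ : ∀ s z, qpK i s z ≠ 0 → tdist1 Nf (ℓB s) (ℓS z) ≤ r) (hℓQs : ∀ z s, qpsK i z s ≠ 0 → tdist1 Nf (ℓS z) (ℓB s) ≤ r)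
    {mS mB : ℕ} (hfibS : ∀ y : UT Nf, (univ.filter fun q : SiteY i × (Fin N × Fin N) => ℓS q.1 = y).card ≤ mS)
    (hfibB : ∀ y : UT Nf, (univ.filter fun p : BlkY i × (Fin N × Fin N) => ℓB p.1 = y).card ≤ mB)
    {ρ BG μ : ℝ}
    (hGp : RawEntryLetters (fun a : Fin (d + 1) → Site (PV d ℓ i.m i.K hd hL) 0 → Matrix (Fin N) (Fin N) ℂ =>
      LinearMap.toMatrix
        ((Pi.basis fun _ : SiteY i => Matrix.stdBasis ℂ (Fin N) (Fin N)).reindex (Equiv.sigmaEquivProd (SiteY i) (Fin N × Fin N)))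
        ((Pi.basis fun _ : SiteY i => Matrix.stdBasis ℂ (Fin N) (Fin N)).reindex (Equiv.sigmaEquivProd (SiteY i) (Fin N × Fin N)))
        (GpY i (parSymY i) (prodCfg U₀ η a)))
      (fun q : SiteY i × (Fin N × Fin N) => ℓS q.1) R ρ BG)
    (hμ : 0 < μ) (hμρ : μ < ρ)
    {κ : ℝ} (hκ : 0 ≤ κ) (hκ4 : κ ≤ (ρ - μ) / 4)
    (hκm : 8 * (Real.sqrt ((((ℓ : ℝ) + 1) ^ i.k) ^ (d + 1)) *
        (CQ * (Fintype.card (Fin N × Fin N) : ℝ) * (1 * ((1 * Real.exp (|η| * Rc)) ^ D * 1 * (1 * Real.exp (|η| * Rc)) ^ D)) *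
          (CQs * (Fintype.card (Fin N × Fin N) : ℝ) * (1 * ((1 * Real.exp (|η| * Rc)) ^ D * 1 * (1 * Real.exp (|η| * Rc)) ^ D))) *
          (BG * BG * (mS * B6.c0 1 μ ^ ν)) * Real.exp (2 * (ρ - μ) * r))) * κ * (mB * B6.c0 1 ((ρ - μ) / 2) ^ ν) ≤
      ((4 * ((d : ℝ) + 1) + 1) ^ 2)⁻¹ * (ρ - μ))
    {ρ'' : ℝ} (hρ''0 : 0 ≤ ρ'') (hρ'' : ρ'' < κ) :
    ∃ R₁ : ℝ, 0 < R₁ ∧ R₁ ≤ R ∧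
      RawEntryLetters (fun a : Fin (d + 1) → Site (PV d ℓ i.m i.K hd hL) 0 → Matrix (Fin N) (Fin N) ℂ =>
          LinearMap.toMatrix
            ((Pi.basis fun _ : BlkY i => Matrix.stdBasis ℂ (Fin N) (Fin N)).reindex (Equiv.sigmaEquivProd (BlkY i) (Fin N × Fin N)))
            ((Pi.basis fun _ : BlkY i => Matrix.stdBasis ℂ (Fin N) (Fin N)).reindex (Equiv.sigmaEquivProd (BlkY i) (Fin N × Fin N)))
            (XinvY i (parSymY i) (GpY i (parSymY i)) (prodCfg U₀ η a)))
        (fun p : BlkY i × (Fin N × Fin N) => ℓB p.1) R₁ ρ''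
        (2 * (1 * 1 * ((N : ℝ) ^ 3 * (Real.sqrt ((((ℓ : ℝ) + 1) ^ i.k) ^ (d + 1)) * (4 / ((4 * ((d : ℝ) + 1) + 1) ^ 2)⁻¹))))) := by
  obtain ⟨hunit, hO⟩ := norm_XinvY_parSymY_single_le_of_letters i hG hU η hR hRRc hD hDs hCQ0 hCQ hCQs0 hCQs ℓS ℓB hℓQ hℓQs hfibS hfibB hGp hμ hμρ hκ hκ4 hκm
  obtain ⟨hU1, hUi1⟩ := norm_unit_le_one_of_mem i hG hU
  -- `G′`'s letters at the lowered rate `κ + μ` (so that the junction's centre rate `(κ + μ) − μ` is the located `κ`)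
  have hκρ : κ + μ ≤ ρ := by linarith
  have hGp' := rawEntryLetters_mono hGp le_rfl hκρ le_rfl
  have hO' : ∀ s t (E : Matrix (Fin N) (Fin N) ℂ), ‖XinvY i (parSymY i) (GpY i (parSymY i)) U₀ (Pi.single s E) t‖ ≤
      (N : ℝ) ^ 3 * (Real.sqrt ((((ℓ : ℝ) + 1) ^ i.k) ^ (d + 1)) * (4 / ((4 * ((d : ℝ) + 1) + 1) ^ 2)⁻¹)) * ‖E‖ *
        Real.exp (-((κ + μ - μ) * tdist1 Nf (ℓB t) (ℓB s))) := fun s t E => by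
    simpa only [add_sub_cancel_right] using hO s t E
  have hBX : 0 ≤ (N : ℝ) ^ 3 * (Real.sqrt ((((ℓ : ℝ) + 1) ^ i.k) ^ (d + 1)) * (4 / ((4 * ((d : ℝ) + 1) + 1) ^ 2)⁻¹)) := by positivity
  have hμκ : μ ≤ κ + μ := by linarith
  have hρ''' : ρ'' < κ + μ - μ := by linarith
  have h := rawEntryLetters_toMatrix_XinvY_parSymY_prodCfg_of_pencil i (Matrix.stdBasis ℂ (Fin N) (Fin N)) U₀ η (GpY i (parSymY i))
    hU1 hUi1 le_rfl hR hD hDs norm_stdBasis_repr_le zero_le_one norm_stdBasis_le_one zero_le_one hCQ0 hCQ hCQs0 hCQs ℓS ℓB hℓQ hℓQs hfibS hfibB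
    hGp' hμ hμκ hunit hBX hO' hρ''0 hρ'''
  have hBG : 0 ≤ BG := hGp.B_nonneg
  refine ⟨_, thinRadius_pos hR ?_, thinRadius_le hR.le ?_, h⟩
  all_goals
    exact mul_nonneg (mul_nonneg (mul_nonneg
      (mul_nonneg (mul_nonneg (mul_nonneg (mul_nonneg (mul_nonneg hCQ0 (Nat.cast_nonneg _)) (by positivity))
        (mul_nonneg (mul_nonneg hCQs0 (Nat.cast_nonneg _)) (by positivity)))
        (mul_nonneg (mul_nonneg hBG hBG) (mul_nonneg (Nat.cast_nonneg _) (pow_nonneg (B6RandomWalk.c0_nonneg 1 _) ν)))) (Real.exp_pos _).le)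
      (mul_nonneg (by positivity) hBX))
      (mul_nonneg (Nat.cast_nonneg _) (pow_nonneg (B6RandomWalk.c0_nonneg 1 _) ν)))
      (mul_nonneg (Nat.cast_nonneg _) (pow_nonneg (B6RandomWalk.c0_nonneg 1 _) ν))

/-! ## §2. ★★★ The X⁻¹ knit on the (3.35) class — no N06 binder left -/

/-- ★★★ **THE X⁻¹ KNIT ON THE (3.35) CLASS.**  For EVERY `U₀ ∈ (bg9K (M_N ℂ) G i).Reg335 c α₀` (`G ≤ U(N)`, `0 ≤ c·M·α₀`, `c·M·α₀·(d+1) ≤ 1∕16`): the N10 letters of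
`A′ ↦ toMatrix B′ B′ ((Q′G′²Q′*)⁻¹(e^{iηA′}U₀))` at the record's matrix units through `ℓB ∘ fst`, rate `ρ″`, constant `2·(1·1·B_X)`, at a thin radius `0 < R₁ ≤ Rc` — `G′`'s
letters by the lane's 79 (Thm 3.1 decay + invertibility, n06-w1 ∕ dag-n06-j), `hunit ∕ hO` by `norm_XinvY_parSymY_single_le_of_reg335` (coercivity, n06-w1, via 80 ∕ 81 + step
(ii)), the junction by n10-w2's XQuadGen: NO N06 binder is displayed.  What remains: NODE 00's dictionary numerals, `η`, `0 < Rc`, the rate chain `0 ≤ ρ″ < κ ≤ (ρ′−μ)∕4`,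
`0 < μ < ρ′ < δ₀κr` (`δ₀ = 1∕(4(d+2))`) and the ONE 81-shape smallness of `κ`.  [cite: Balaban1985BackgroundPropagators, (3.25) p.394, (3.35) p.396, Thm 3.1 (3.42) p.397,
Thm 3.2 (3.48) pp.398–399, Thm 3.4 p.400, (3.66)–(3.70) pp.403–404, Thm 3.10 (3.107)–(3.108) p.416; Balaban1984PropagatorsII, Prop 2.3 p.238, Lemma 2.1 (2.61) p.234;
Balaban1988RG2Cluster, (2.5)–(2.7) pp.12–13, p.15] -/
theorem rawEntryLetters_toMatrix_XinvY_parSymY_prodCfg_of_reg335 (hG : G ≤ B7Prop2Explicit.unitaryUnits (Matrix (Fin N) (Fin N) ℂ))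
    {U₀ : CfgY (Matrix (Fin N) (Fin N) ℂ) i} {c α₀ : ℝ} (hC0 : 0 ≤ c * (kGeo i).M * α₀) (hC1 : c * (kGeo i).M * α₀ * ((d : ℝ) + 1) ≤ 1 / 16)
    (hreg : (bg9K (Matrix (Fin N) (Fin N) ℂ) G i).Reg335 c α₀ U₀)
    (η : ℝ) {Rc : ℝ} (hRc : 0 < Rc) {D' : ℕ}
    (hD' : ∀ z w, avgCoeffY i z w ≠ 0 →
      Site.tdist ((boxEquiv i.hN).symm z) ((boxEquiv i.hN).symm (cornerY i (levY i z) z)) +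
        Site.tdist ((boxEquiv i.hN).symm (cornerY i (levY i z) z)) ((boxEquiv i.hN).symm w) ≤ D')
    {Cavg : ℝ} (hCavg0 : 0 ≤ Cavg) (hCavg : ∀ z, ∑ w, |avgCoeffY i z w| ≤ Cavg)
    {D : ℕ}
    (hD : ∀ s z, qpK i s z ≠ 0 → Site.tdist ((boxEquiv i.hN).symm (blkCornerY i s)) ((boxEquiv i.hN).symm z) ≤ D)
    (hDs : ∀ z s, qpsK i z s ≠ 0 → Site.tdist ((boxEquiv i.hN).symm (blkCornerY i s)) ((boxEquiv i.hN).symm z) ≤ D)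
    {CQ CQs : ℝ} (hCQ0 : 0 ≤ CQ) (hCQ : ∀ s, ∑ z, |qpK i s z| ≤ CQ) (hCQs0 : 0 ≤ CQs) (hCQs : ∀ s, ∑ z, |qpsK i z s| ≤ CQs)
    (ℓS : SiteY i → UT Nf) (ℓB : BlkY i → UT Nf) {s : ℝ} (hs0 : 0 ≤ s)
    (hℓ : ∀ μ z, tdist1 Nf (ℓS (shiftY i μ z)) (ℓS z) ≤ s) (hℓa : ∀ z w, avgCoeffY i z w ≠ 0 → tdist1 Nf (ℓS z) (ℓS w) ≤ s)
    {κr : ℝ} (hκ0 : 0 ≤ κr)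
    (hκr : ∀ z w : SiteY i, κr * tdist1 Nf (ℓS z) (ℓS w) ≤ ((((ℓ + 1) ^ i.k : ℕ) : ℝ))⁻¹ * torusSupNorm (toKT i).NB (z.1 - w.1))
    {r : ℝ} (hℓQ : ∀ s z, qpK i s z ≠ 0 → tdist1 Nf (ℓB s) (ℓS z) ≤ r) (hℓQs : ∀ z s, qpsK i z s ≠ 0 → tdist1 Nf (ℓS z) (ℓB s) ≤ r)
    {mS mB : ℕ} (hfibS : ∀ y : UT Nf, (univ.filter fun q : SiteY i × (Fin N × Fin N) => ℓS q.1 = y).card ≤ mS)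
    (hfibB : ∀ y : UT Nf, (univ.filter fun p : BlkY i × (Fin N × Fin N) => ℓB p.1 = y).card ≤ mB)
    {ρ' : ℝ} (hρ'0 : 0 ≤ ρ') (hρ' : ρ' < (1 / (4 * ((d : ℝ) + 2))) * κr)
    {μ : ℝ} (hμ : 0 < μ) (hμρ : μ < ρ')
    {κ : ℝ} (hκ : 0 ≤ κ) (hκ4 : κ ≤ (ρ' - μ) / 4)
    (hκm : 8 * (Real.sqrt ((((ℓ : ℝ) + 1) ^ i.k) ^ (d + 1)) *
        (CQ * (Fintype.card (Fin N × Fin N) : ℝ) * (1 * ((1 * Real.exp (|η| * Rc)) ^ D * 1 * (1 * Real.exp (|η| * Rc)) ^ D)) *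
          (CQs * (Fintype.card (Fin N × Fin N) : ℝ) * (1 * ((1 * Real.exp (|η| * Rc)) ^ D * 1 * (1 * Real.exp (|η| * Rc)) ^ D))) *
          ((2 * (1 * 1 * (16 * ((((ℓ + 1) ^ i.k : ℕ) : ℝ)) ^ 2 * Real.sqrt N))) * (2 * (1 * 1 * (16 * ((((ℓ + 1) ^ i.k : ℕ) : ℝ)) ^ 2 * Real.sqrt N))) *
            (mS * B6.c0 1 μ ^ ν)) * Real.exp (2 * (ρ' - μ) * r))) * κ * (mB * B6.c0 1 ((ρ' - μ) / 2) ^ ν) ≤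
      ((4 * ((d : ℝ) + 1) + 1) ^ 2)⁻¹ * (ρ' - μ))
    {ρ'' : ℝ} (hρ''0 : 0 ≤ ρ'') (hρ'' : ρ'' < κ) :
    ∃ R₁ : ℝ, 0 < R₁ ∧ R₁ ≤ Rc ∧
      RawEntryLetters (fun a : Fin (d + 1) → Site (PV d ℓ i.m i.K hd hL) 0 → Matrix (Fin N) (Fin N) ℂ =>
          LinearMap.toMatrix
            ((Pi.basis fun _ : BlkY i => Matrix.stdBasis ℂ (Fin N) (Fin N)).reindex (Equiv.sigmaEquivProd (BlkY i) (Fin N × Fin N)))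
            ((Pi.basis fun _ : BlkY i => Matrix.stdBasis ℂ (Fin N) (Fin N)).reindex (Equiv.sigmaEquivProd (BlkY i) (Fin N × Fin N)))
            (XinvY i (parSymY i) (GpY i (parSymY i)) (prodCfg U₀ η a)))
        (fun p : BlkY i × (Fin N × Fin N) => ℓB p.1) R₁ ρ''
        (2 * (1 * 1 * ((N : ℝ) ^ 3 * (Real.sqrt ((((ℓ : ℝ) + 1) ^ i.k) ^ (d + 1)) * (4 / ((4 * ((d : ℝ) + 1) + 1) ^ 2)⁻¹))))) := by
  -- `G′`'s letters on the class (lane module 79, record coordinates) at its located thin radius `R⋆`, `0 < R⋆ ≤ Rc`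
  have hGp := rawEntryLetters_toMatrix_GpY_parSymY_prodCfg_of_reg335_record i hG hC0 hC1 hreg η hRc hD' hCavg0 hCavg ℓS hs0 hℓ hℓa hκ0 hκr hfibS hρ'0 hρ'
  have hT : 0 ≤ (1 * (((d : ℝ) + 1) *
        (1 * Real.exp (|η| * Rc) * (1 * Real.exp (|η| * Rc) * 1 * (1 * Real.exp (|η| * Rc)) + 1) * (1 * Real.exp (|η| * Rc)) +
          (1 * Real.exp (|η| * Rc) * 1 * (1 * Real.exp (|η| * Rc)) + 1)) +
        Cavg * ((1 * Real.exp (|η| * Rc)) ^ D' * 1 * (1 * Real.exp (|η| * Rc)) ^ D')) * Real.exp ((1 / (4 * ((d : ℝ) + 2)) * κr) * s)) *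
        (1 * 1 * (16 * ((((ℓ + 1) ^ i.k : ℕ) : ℝ)) ^ 2 * Real.sqrt N)) *
        (mS * B6.c0 1 (((1 / (4 * ((d : ℝ) + 2))) * κr - ρ') / 3) ^ ν) * (mS * B6.c0 1 (((1 / (4 * ((d : ℝ) + 2))) * κr - ρ') / 3) ^ ν) :=
    mul_nonneg (mul_nonneg (mul_nonneg
      (mul_nonneg (mul_nonneg zero_le_one (add_nonneg (by positivity) (mul_nonneg hCavg0 (by positivity)))) (Real.exp_pos _).le)
      (by positivity)) (mul_nonneg (Nat.cast_nonneg _) (pow_nonneg (B6RandomWalk.c0_nonneg 1 _) ν)))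
      (mul_nonneg (Nat.cast_nonneg _) (pow_nonneg (B6RandomWalk.c0_nonneg 1 _) ν))
  obtain ⟨R₁, hR₁, hR₁R, h⟩ := rawEntryLetters_toMatrix_XinvY_parSymY_prodCfg_of_letters_located i hG hreg.1 η (thinRadius_pos hRc hT)
    (thinRadius_le hRc.le hT) hD hDs hCQ0 hCQ hCQs0 hCQs ℓS ℓB hℓQ hℓQs hfibS hfibB hGp hμ hμρ hκ hκ4 hκm hρ''0 hρ''
  exact ⟨R₁, hR₁, hR₁R.trans (thinRadius_le hRc.le hT), h⟩

end Literature.MathematicalPhysics.QuantumFieldTheory.Balaban1983to89.B13XinvSymLettersOfReg335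

end
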